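import Summits.AtomisticToContinuum.HydrodynamicLimit.Theorems.EnskogAdjointDualityCollisionResidualVanishesCutCloses
import Summits.AtomisticToContinuum.HydrodynamicLimit.Theorems.EnskogAdjointDualityCollisionResidualVanishesConjunctGrade
import Mathlib.InformationTheory.KullbackLeibler.Basic
import HarnessLib

/-!
# Strategy census (crux-strategist s1, 2026-08-17) — typed signatures for
`EnskogAdjointDuality.CollisionResidualVanishes` (K1, stmt-AtomisticToContinuum-14658)

Scratch file of the crux-strategist seat (NOT a line, NOT a proposal). It types the objects named in
`STRATEGY-CENSUS.md`:

* `HydroLimitAllWindows` — the packing-guarded conjunct body at every EOS window (= the live line's STUB 1);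
* `CollisionResidualVanishesRegularAt η₁` / `NondualRegular` — K1's conclusion on the TIME-REGULAR admissible
  families (C¹ along free flight, crude polynomial defect bound; NO approximate duality, NO terminal form):
  sits between K1 and the cutoff-dual candidate (`dualCutAt_of_regularAt`, `nondualRegular_of_collisionResidualVanishes`);
* `IrregularExtension := NondualRegular → K1` — the residue of K1 carried ONLY by families without an
  `N`-uniform modulus of continuity in time (the census' Negation / Decomposition finding);
* `RelEntropyInBandAt η₀` — the Yau-form (relative entropy `o(N)` w.r.t. local Gibbs with the Euler parameters)
  at threshold `η₀` (body of the shared item `RelEntropyVanishingInBand`, stmt-AtomisticToContinuum-17396, with `η₀` free);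
* `EntropySandwichAt η₁ := HydroLimitInBandAt η₁ → RelEntropyInBandAt η₁` — the census' STRENGTHEN finding
  (S ⇒ S⁺ by Liouville entropy conservation + isentropy of classical hs-Euler + thermodynamic limit of local Gibbs
  entropy at small packing; provable-in-principle, XL);
* `CubicMomentUIInBandAt η₁` — packing-guarded cubic velocity-moment UI at positive times (guarded copy of the
  sub's `CubicMomentUI`, stmt-AtomisticToContinuum-9245);
* `RegularResidualOfEntropy` — S⁺ ∧ cubic UI ⇒ the time-regular residue (entropy inequality LLN at each time +
  the pathwise balance identity + consistency `Res_N[φ^N] → 0`; provable-in-principle, L/XL);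
* `collisionResidualVanishes_of_split` — the best typed split found (5 pieces), PROVED as pure logic; piece 1 is the
  summit body (≥ S), piece 5 (`IrregularExtension`) is the part of K1 beyond S with no technique — see the census.
-/

noncomputable section

open MeasureTheory Set Filter Topology Function

namespace Summit.AtomisticToContinuum.HydrodynamicLimit.Cruxes.CollisionResidualVanishes.StrategyCensus

open Literature.Analysis.FluidPDE Literature.MathematicalPhysics.KineticTheory
  Literature.Analysis.FunctionSpaces
open Summit.AtomisticToContinuum.HydrodynamicLimit.Theses.EnskogAdjointDuality (CollisionResidualVanishes)
open Summit.AtomisticToContinuum.HydrodynamicLimit.Theorems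
  (HydroLimitInBandAt CollisionResidualVanishesDualCutAt CollisionResidualVanishesDualCut)

/-! ## 1. The summit body at every EOS window (the live line's STUB 1, restated locally) -/

/-- The packing-guarded conjunct body at every EOS window. -/
def HydroLimitAllWindows : Prop :=
  ∀ η₁ : ℝ, 0 < η₁ →
    AnalyticOnNhd ℝ hsExcessFreeEnergy (Set.Ioo 0 η₁) →
    (∀ η ∈ Set.Ioo 0 η₁, 0 < deriv hsExcessFreeEnergy η) →
    (∀ η ∈ Set.Ioo 0 η₁, 0 < deriv (fun x : ℝ => x * hsCompressibility x) η) →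
    HydroLimitInBandAt η₁

/-- STUB 1 is at least the summit (by name, K2R-free). -/
theorem summit_of_hydroLimitAllWindows (h : HydroLimitAllWindows) : _root_.HydrodynamicLimit :=
  Summit.AtomisticToContinuum.HydrodynamicLimit.Theorems.hydrodynamicLimit_of_forall_hydroLimitInBandAt h

/-! ## 2. K1 on the TIME-REGULAR admissible families -/

/-- **K1's conclusion on the time-regular admissible families, at EOS window `η₁`.** Verbatim
`CollisionResidualVanishesDualCutAt η₁` with the duality-specific premises deleted: no terminal form (i), no small
defect, no convergence of `c^N(0)` (iv), no `Res_N → 0` (v); the family is only asked to be, eventually in `N`, `C¹`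
along free flights with the crude global bound `|Dφ^N + L^Nφ^N| ≤ C_g (1+‖v‖²)³`. -/
def CollisionResidualVanishesRegularAt (η₁ : ℝ) : Prop :=
  ∀ (a₀ θ₀ : UnitAddTorus (Fin 3) → ℝ) (u₀ : UnitAddTorus (Fin 3) → EuclideanSpace ℝ (Fin 3)), Continuous a₀ →
    Continuous θ₀ → Continuous u₀ → (∀ x, 0 < a₀ x) → (∀ x, 0 < θ₀ x) → ∃ σ₀ : ℝ, 0 < σ₀ ∧ ∀ σ : ℝ, 0 < σ →
    σ < σ₀ →
    ∀ (T : ℝ) (ρ θ : ℝ → UnitAddTorus (Fin 3) → ℝ) (u : ℝ → UnitAddTorus (Fin 3) → EuclideanSpace ℝ (Fin 3)), Literature.MathematicalPhysics.KineticTheory.IsHardSphereEulerSolution σ T ρ u θ →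
    ∀ Φ : (N : ℕ) →
    Literature.Analysis.FluidPDE.HardSphereFlow (Literature.Analysis.FluidPDE.Torus.geometry (Fin 3)) (Literature.MathematicalPhysics.KineticTheory.hsDiameter σ N) (N + 1), Literature.MathematicalPhysics.KineticTheory.TendstoHydroFieldsAt (fun N => Literature.MathematicalPhysics.KineticTheory.localGibbsLaw σ a₀ u₀ θ₀ N (Φ N)) Φ ρ u θ 0 →
    ∀ t ∈ Set.Ico 0 T, (∀ s ∈ Set.Icc 0 t, ∀ x, ρ s x * σ ^ 3 < η₁) →
    ∀ (c : ℕ → ℝ → UnitAddTorus (Fin 3) → ℝ × EuclideanSpace ℝ (Fin 3) × ℝ) (κ : ℕ → ℝ → UnitAddTorus (Fin 3) → EuclideanSpace ℝ (Fin 3) → ℝ), (∀ N, Continuous (Function.uncurry (c N))) →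
    (∀ N, Continuous (fun p : ℝ × UnitAddTorus (Fin 3) × EuclideanSpace ℝ (Fin 3) => κ N p.1 p.2.1 p.2.2)) →
    (∃ C : ℝ, ∀ N s x x' v v', ‖c N s x‖ ≤ C ∧ dist (c N s x) (c N s x') ≤ C * dist x x' ∧ |κ N s x v| ≤ C * (1 + ‖v‖ ^ 2) ∧ |κ N s x v - κ N s x' v'| ≤ C * (1 + ‖v‖ ^ 2 + ‖v'‖ ^ 2) * (dist x x' + ‖v - v'‖)) →
    let G := Literature.Analysis.FluidPDE.Torus.geometry (Fin 3)
    let ε := fun N : ℕ => Literature.MathematicalPhysics.KineticTheory.hsDiameter σ N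
    let lam := fun N : ℕ => (N : ℝ) * ε N ^ 2
    let f := fun (s : ℝ) (x : UnitAddTorus (Fin 3)) (v : EuclideanSpace ℝ (Fin 3)) => ρ s x * Literature.Analysis.FluidPDE.localMaxwellian 1 (θ s x) (u s x) v
    let Y := fun η : ℝ => 3 / (2 * Real.pi) * deriv Literature.MathematicalPhysics.KineticTheory.hsExcessFreeEnergy η
    let φ := fun (N : ℕ) (s : ℝ) (x : UnitAddTorus (Fin 3)) (v : EuclideanSpace ℝ (Fin 3)) => (c N s x).1 + inner ℝ (c N s x).2.1 v + (c N s x).2.2 * ‖v‖ ^ 2 / 2 + (lam N)⁻¹ * κ N s x v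
    let L := fun (N : ℕ) (s : ℝ) (x : UnitAddTorus (Fin 3)) (v : EuclideanSpace ℝ (Fin 3)) => lam N * ∫ ω : Metric.sphere (0 : EuclideanSpace ℝ (Fin 3)) 1, (let y := G.translate x (ε N • (ω : EuclideanSpace ℝ (Fin 3))); ∫ w : EuclideanSpace ℝ (Fin 3), max (inner ℝ (v - w) ω) 0 * Y (σ ^ 3 * ρ s (G.translate x ((ε N / 2) • (ω : EuclideanSpace ℝ (Fin 3))))) * f s y w * (φ N s x (v - inner ℝ (v - w) ω • (ω : EuclideanSpace ℝ (Fin 3))) + φ N s y (w + inner ℝ (v - w) ω • (ω : EuclideanSpace ℝ (Fin 3))) - φ N s x v - φ N s y w)) ∂Literature.MathematicalPhysics.KineticTheory.sphereMeasure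
    let R := fun (N : ℕ) (z : Literature.Analysis.FluidPDE.Config (N + 1) (Fin 3) (UnitAddTorus (Fin 3))) => (let q := fun r : ℝ => (Φ N).flow r z; (N + 1 : ℝ)⁻¹ * (∑ᶠ (s : ℝ) (_ : s ∈ Literature.Analysis.FluidPDE.collisionTimes G (ε N) q ∩ Set.Ioc 0 t), ∑ i, ∑ j, (if i ≠ j ∧ ‖G.sepVec (q s i).1 (q s j).1‖ = ε N then φ N s (q s i).1 (q s i).2 - φ N s (q s i).1 (Literature.Analysis.FluidPDE.reflectVel (G.sepVec (q s i).1 (q s j).1) ((q s i).2, (q s j).2)).1 else 0)) - (∫ s in Set.Icc 0 t, ∫ y, L N s y.1 y.2 ∂(Literature.Analysis.FluidPDE.empiricalMeasure (q s))) + (1 / 2 : ℝ) * ∫ s in Set.Icc 0 t, ∫ x : UnitAddTorus (Fin 3), ∫ v : EuclideanSpace ℝ (Fin 3), f s x v * L N s x v)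
    (∃ Cg : ℝ, ∀ᶠ N in Filter.atTop, (∀ x v, ContDiffOn ℝ 1 (fun r => φ N r (G.translate x (r • v)) v) (Set.Icc 0 t)) ∧ (∀ s ∈ Set.Icc 0 t, ∀ x v, |derivWithin (fun r => φ N r (G.translate x ((r - s) • v)) v) (Set.Icc 0 t) s + L N s x v| ≤ Cg * (1 + ‖v‖ ^ 2) ^ 3)) →
    Filter.Tendsto (fun N : ℕ => ∫⁻ z, ENNReal.ofReal (R N z ^ 2) ∂(Literature.MathematicalPhysics.KineticTheory.localGibbsLaw σ a₀ u₀ θ₀ N (Φ N))) Filter.atTop (nhds 0)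

/-- K1 on the time-regular families, at every EOS window (the "time-regular nondual residue" of the census). -/
def NondualRegular : Prop :=
  ∀ η₁ : ℝ, 0 < η₁ →
    AnalyticOnNhd ℝ hsExcessFreeEnergy (Set.Ioo 0 η₁) →
    (∀ η ∈ Set.Ioo 0 η₁, 0 < deriv hsExcessFreeEnergy η) →
    (∀ η ∈ Set.Ioo 0 η₁, 0 < deriv (fun x : ℝ => x * hsCompressibility x) η) →
    CollisionResidualVanishesRegularAt η₁

/-- **The over-strength residue of K1 beyond time-regular families**: extending the mean-square vanishing of `𝓡_N`
from the time-regular families to ALL admissible families (no `N`-uniform modulus of continuity in `s`). -/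
def IrregularExtension : Prop :=
  NondualRegular → CollisionResidualVanishes

/-- K1 as typed implies its time-regular restriction (trivial weakening). -/
theorem nondualRegular_of_collisionResidualVanishes (h : CollisionResidualVanishes) : NondualRegular := by
  intro η₁ hη₁ hA hB hC a₀ θ₀ u₀ ha hθ hu ha0 hθ0
  obtain ⟨σ₀, hσ₀, H⟩ := h η₁ hη₁ hA hB hC a₀ θ₀ u₀ ha hθ hu ha0 hθ0
  refine ⟨σ₀, hσ₀, fun σ hσ hσlt T ρ θ u hE Φ h0 t ht hg c κ hc hκ hadm => ?_⟩
  intro G ε lam f Y φ L R _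
  exact H σ hσ hσlt T ρ θ u hE Φ h0 t ht hg c κ hc hκ hadm

/-- Exact anatomy: K1 ⟺ (time-regular residue) ∧ (irregular extension). -/
theorem collisionResidualVanishes_iff_regular_and_irregular :
    CollisionResidualVanishes ↔ NondualRegular ∧ IrregularExtension :=
  ⟨fun h => ⟨nondualRegular_of_collisionResidualVanishes h, fun _ => h⟩, fun h => h.2 h.1⟩

/-- The time-regular residue contains the cutoff-dual candidate (window by window): a cutoff-dual family is in
particular time-regular with the same crude bound. -/
theorem dualCutAt_of_regularAt {η₁ : ℝ} (h : CollisionResidualVanishesRegularAt η₁) :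
    CollisionResidualVanishesDualCutAt η₁ := by
  intro a₀ θ₀ u₀ ha hθ hu ha0 hθ0
  obtain ⟨σ₀, hσ₀, H⟩ := h a₀ θ₀ u₀ ha hθ hu ha0 hθ0
  refine ⟨σ₀, hσ₀, ?_⟩
  intro σ hσ hσlt T ρ θ u hEul Φ hLLN t ht hg c κ hc hκ hadm G ε lam f Y φ L R χ _ a e b _ hreg _ _
  refine H σ hσ hσlt T ρ θ u hEul Φ hLLN t ht hg c κ hc hκ hadm ?_
  obtain ⟨η, _, Cg, hev⟩ := hreg
  exact ⟨Cg, hev.mono fun N hN => ⟨hN.1, hN.2.2⟩⟩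

/-- Hence `NondualRegular` implies the cutoff-dual restatement candidate K1′. -/
theorem dualCut_of_nondualRegular (h : NondualRegular) : CollisionResidualVanishesDualCut :=
  fun η₁ hη₁ hA hB hC => dualCutAt_of_regularAt (h η₁ hη₁ hA hB hC)

/-! ## 3. STRENGTHEN: the Yau form at threshold `η₀`, and the entropy sandwich -/

/-- **Relative entropy `o(N)` w.r.t. local Gibbs with the Euler parameters, at threshold `η₀`** — verbatim the body of
the shared sub-problem item `RelEntropyVanishingInBand` (stmt-AtomisticToContinuum-17396, e.g.
`Theses.AnosovDiceHopf.RelEntropyVanishingInBand`) with its outermost `∃ η₀` made a parameter. -/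
def RelEntropyInBandAt (η₀ : ℝ) : Prop :=
  ∀ (a₀ θ₀ : T3 → ℝ) (u₀ : T3 → V3), Continuous a₀ → Continuous θ₀ → Continuous u₀ → (∀ x, 0 < a₀ x) → (∀ x, 0 < θ₀ x) → ∃ σ₀ : ℝ, 0 < σ₀ ∧ ∀ σ : ℝ, 0 < σ → σ < σ₀ → ∀ (T : ℝ) (ρ θ : ℝ → T3 → ℝ) (u : ℝ → T3 → V3), IsHardSphereEulerSolution σ T ρ u θ → (∀ t ∈ Set.Ico 0 T, ∀ x, ρ t x * σ ^ 3 < η₀) → ∀ Φ : (N : ℕ) → Literature.Analysis.FluidPDE.HardSphereFlow (Literature.Analysis.FluidPDE.Torus.geometry (Fin 3)) (hsDiameter σ N) (N + 1), (∀ N, MeasureTheory.IsProbabilityMeasure (localGibbsLaw σ a₀ u₀ θ₀ N (Φ N))) ∧ (TendstoHydroFieldsAt (fun N => localGibbsLaw σ a₀ u₀ θ₀ N (Φ N)) Φ ρ u θ 0 → ∀ t ∈ Set.Ico 0 T, ∃ a : T3 → ℝ, (∀ N, MeasureTheory.IsProbabilityMeasure (localGibbsLaw σ a (u t) (θ t)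 N (Φ N))) ∧ (∀ χ : T3 → ℝ, Continuous χ → ∀ δ : ℝ, 0 < δ → ∃ C : ℝ, 0 < C ∧ ∀ N : ℕ, localGibbsLaw σ a (u t) (θ t) N (Φ N) {z | δ < |empiricalDensityField z χ - ∫ x, χ x * ρ t x|} ≤ ENNReal.ofReal (C * Real.exp (-(C⁻¹ * (N + 1)))) ∧ localGibbsLaw σ a (u t) (θ t) N (Φ N) {z | δ < ‖empiricalMomentumField z χ - ∫ x, (χ x * ρ t x) • u t x‖} ≤ ENNReal.ofReal (C * Real.exp (-(C⁻¹ * (N + 1)))) ∧ localGibbsLaw σ a (u t) (θ t) N (Φ N) {z | δ < |empiricalEnergyField z χ - ∫ x, χ x * totalEnergyDensity (ρ t x) (u t x) (θ t x)|} ≤ ENNReal.ofReal (C * Real.exp (-(C⁻¹ * (N + 1))))) ∧ Filter.Tendsto (fun N : ℕ => InformationTheory.klDiv ((Φ N).lawAt (localGibbsLaw σ a₀ u₀ θ₀ N (Φ N)) t) (localGibbsLaw σ a (u t) (θ t) N (Φ N)) / ((N : ENNReal) + 1)) Filter.atTop (nhds 0))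

/-- **ENTROPY SANDWICH at window `η₁`** (census STRENGTHEN finding; a conjecture-free theorem-to-be, XL):
the packing-guarded hydrodynamic limit at threshold `η₁` implies the Yau form at `η₁`. Mechanism:
`H(P_s | G*_s) = −S(P_s) − E_{P_s} log G*_s`, `S(P_s) = S(P_0) = S(G*_0)` (Liouville), `E_{P_s} log G*_s` is a
HYDRODYNAMIC-FIELD functional (quadratic in `v`) so it is given by S (+ energy UI from pathwise energy conservation),
and `S(G*_s) − S(G*_0) = (N+1)[∫ρ_s s(ρ_s,θ_s) − ∫ρ_0 s(ρ_0,θ_0)] + o(N) = o(N)` because classical hs-Euler flow is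
isentropic; the static inputs (local thermodynamics of the dilute hard-sphere gas, activity ↔ density, LD of local
Gibbs fields) live on the EOS-analytic band. -/
def EntropySandwichAt (η₁ : ℝ) : Prop :=
  HydroLimitInBandAt η₁ → RelEntropyInBandAt η₁

/-! ## 4. Cubic velocity-moment UI at positive times, packing-guarded -/

/-- **Cubic velocity-moment UI along the evolution, guarded at `η₁`** — the sub's `CubicMomentUI`
(stmt-AtomisticToContinuum-9245, routes GasHeatBath / HeatBathCells) with the Statement's packing guard inserted. -/
def CubicMomentUIInBandAt (η₁ : ℝ) : Prop :=
  ∀ (a₀ θ₀ : T3 → ℝ) (u₀ : T3 → V3), Continuous a₀ → Continuous θ₀ → Continuous u₀ → (∀ x, 0 < a₀ x) → (∀ x, 0 < θ₀ x) → ∃ σ₀ : ℝ, 0 < σ₀ ∧ ∀ σ : ℝ, 0 < σ → σ < σ₀ → ∀ (T : ℝ) (ρ θ : ℝ → T3 → ℝ) (u : ℝ → T3 → V3), IsHardSphereEulerSolution σ T ρ u θ → ∀ Φ : (N : ℕ) → Literature.Analysis.FluidPDE.HardSphereFlow (Literature.Analysis.FluidPDE.Torus.geometry (Fin 3)) (hsDiameter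 σ N) (N + 1), TendstoHydroFieldsAt (fun N => localGibbsLaw σ a₀ u₀ θ₀ N (Φ N)) Φ ρ u θ 0 → ∀ t ∈ Set.Ico 0 T, (∀ s ∈ Set.Icc 0 t, ∀ x, ρ s x * σ ^ 3 < η₁) → ∀ δ : ℝ, 0 < δ → ∃ K₀ : ℝ, ∃ N₀ : ℕ, ∀ N : ℕ, N₀ ≤ N → ∀ s ∈ Set.Icc 0 t, ∫⁻ z, ENNReal.ofReal (∫ y, (if K₀ < ‖y.2‖ then ‖y.2‖ ^ 3 else 0) ∂(Literature.Analysis.FluidPDE.empiricalMeasure ((Φ N).flow s z))) ∂(localGibbsLaw σ a₀ u₀ θ₀ N (Φ N)) ≤ ENNReal.ofReal δ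

/-- **The time-regular residue from the Yau form + cubic UI** (census DECOMPOSITION piece; a theorem-to-be, L/XL):
relative entropy `o(N)` at every `s ≤ t` gives the one-body LLN at each `s` for sub-quadratic observables (entropy
inequality, Kipnis–Landim Ch. 6 Cor. 1.3), cubic UI truncates the cubic growth of `(D + L^N_s)φ^N_s`, the pathwise
balance identity `C_N[φ] = ⟨μ_t,φ_t⟩ − ⟨μ_0,φ_0⟩ − ∫⟨μ_s,Dφ_s⟩` (time-regular families only!) turns `𝓡_N` into
one-time pairings, and `Res_N[φ^N] → 0` is consistency of the hs-Euler local Maxwellian with the Enskog collisional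
transfer. -/
def RegularResidualOfEntropy : Prop :=
  ∀ η₁ : ℝ, 0 < η₁ → AnalyticOnNhd ℝ hsExcessFreeEnergy (Set.Ioo 0 η₁) →
    RelEntropyInBandAt η₁ → CubicMomentUIInBandAt η₁ → CollisionResidualVanishesRegularAt η₁

/-! ## 5. The best typed split found (census DECOMPOSITION), proved as pure logic -/

/-- **K1 from five pieces**: (1) the summit body at every window (≥ S), (2) the entropy sandwich at every window
(provable, XL), (3) guarded cubic UI at every window (open, shared-grade), (4) the regular residue from entropy
(provable, L/XL), (5) the irregular extension (open; K1's over-strength beyond S, no technique). -/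
theorem collisionResidualVanishes_of_split
    (h₁ : HydroLimitAllWindows)
    (h₂ : ∀ η₁ : ℝ, 0 < η₁ → AnalyticOnNhd ℝ hsExcessFreeEnergy (Set.Ioo 0 η₁) → EntropySandwichAt η₁)
    (h₃ : ∀ η₁ : ℝ, 0 < η₁ → AnalyticOnNhd ℝ hsExcessFreeEnergy (Set.Ioo 0 η₁) → CubicMomentUIInBandAt η₁)
    (h₄ : RegularResidualOfEntropy)
    (h₅ : IrregularExtension) : CollisionResidualVanishes :=
  h₅ fun η₁ hη₁ hA hB hC =>
    h₄ η₁ hη₁ hA (h₂ η₁ hη₁ hA (h₁ η₁ hη₁ hA hB hC)) (h₃ η₁ hη₁ hA)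

/-- Sanity: pieces (1)–(4) alone already give the cutoff-dual restatement candidate K1′ (so a K1 restated to
time-regular or cutoff-dual families is reached WITHOUT piece (5)). -/
theorem dualCut_of_split
    (h₁ : HydroLimitAllWindows)
    (h₂ : ∀ η₁ : ℝ, 0 < η₁ → AnalyticOnNhd ℝ hsExcessFreeEnergy (Set.Ioo 0 η₁) → EntropySandwichAt η₁)
    (h₃ : ∀ η₁ : ℝ, 0 < η₁ → AnalyticOnNhd ℝ hsExcessFreeEnergy (Set.Ioo 0 η₁) → CubicMomentUIInBandAt η₁)
    (h₄ : RegularResidualOfEntropy) : CollisionResidualVanishesDualCut :=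
  dualCut_of_nondualRegular fun η₁ hη₁ hA hB hC =>
    h₄ η₁ hη₁ hA (h₂ η₁ hη₁ hA (h₁ η₁ hη₁ hA hB hC)) (h₃ η₁ hη₁ hA)

/-- … and of course piece (1) alone gives K1′ too (the lead's K2R-free converse duality,
`dualCut_of_forall_hydroLimitInBandAt`): the entropy pieces (2)–(4) matter only for the NON-dual time-regular
families, i.e. for `NondualRegular` proper. -/
theorem dualCut_of_allWindows' (h₁ : HydroLimitAllWindows) : CollisionResidualVanishesDualCut :=
  Summit.AtomisticToContinuum.HydrodynamicLimit.Theorems.dualCut_of_forall_hydroLimitInBandAt h₁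

end Summit.AtomisticToContinuum.HydrodynamicLimit.Cruxes.CollisionResidualVanishes.StrategyCensus

end
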